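import Mathlib
import Literature.Analysis.FluidPDE.NSFourierMild
import Literature.Analysis.FluidPDE.NSFourierAPriori
import HarnessLib

/-!
# Route FrozenSignCascade · crux `EnvelopeBound` — stub `stub_mildUnique`: uniqueness of
  Fourier-side mild solutions

Helper file for the crux item stmt-NavierStokesRegularity-1549 (`FrozenSignCascade.EnvelopeBound`),
line `registered`; lands `--supports` that item and closes the registered stub `stub_mildUnique`.

**Uniqueness in the Fourier-mild class.** Two Fourier-side mild solutions `V`, `W` of the
transformed Navier–Stokes system on `ℝ³` (`FourierNS.IsFourierMild c K₀ t₀ T V`,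
`FourierNS.IsFourierMild c K₀ t₀ T' W`: same heat rate `c` and weight order `K₀`) with
`V t₀ = W t₀` agree at every time `t` with `t₀ ≤ t ≤ min T T'`.

Proof (Leray 1934, §21; Lemarié-Rieusset 2016, Thm. 7.2): both solutions carry the order-`K₀`
weight `R` uniformly in time, so on a window `[0, τ₁]` of length `τ₁ ≤ T_P = picardTime c K₀ R`
the two-time Duhamel formulas from the left end point, the bilinearity
`N(V,V) − N(W,W) = N(V−W, V) + N(W, V−W)`, the convolution estimate `norm_nonlin_le` and the heat
gain `integral_heat_mul_le` (with the time weight `e^{s/T_P}`, exactly the contraction estimate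
`hasDecay_duhamel_sub` of the Picard map) halve any uniform weighted bound
`‖V(r) − W(r)‖ ≤ D (1+‖·‖)^{-K₀}` on the window (`hasDecay_sub_half`). Starting from `D = 2R` and
iterating, the difference is bounded by `2R/2ⁿ` for every `n`, hence vanishes (`eq_on_window`).
The general statement follows by induction over windows of the fixed length `T_P`, re-basing the
solutions at the left end point of each window (`IsFourierMild.mono`, `IsFourierMild.translate`).
-/

noncomputable section

set_option linter.dupNamespace false -- nested layout Summit.<S>.<Sub>, Sub = S (D-0017)

open MeasureTheory Set Filter Topology
open Literature.Analysis.FluidPDE.FourierNS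

namespace Summit.NavierStokesRegularity.NavierStokesRegularity.Theorems.EnvelopeBound.Registered

variable {c τ₁ R D : ℝ} {K₀ : ℕ} {V W : ℝ → EuclideanSpace ℝ (Fin 3) → Fin 3 → ℂ}

/-- **Contraction of the weighted distance on a short window.** If `V`, `W` are mild on
`[0, τ₁]`, `τ₁ ≤ picardTime c K₀ R`, agree at time `0`, stay in the order-`K₀` ball of radius `R`
and satisfy `‖V(r) − W(r)‖ ≤ D (1+‖·‖)^{-K₀}` for `r ∈ [0, τ₁]`, then
`‖V(t) − W(t)‖ ≤ (D/2) (1+‖·‖)^{-K₀}` for `t ∈ [0, τ₁]` (the estimate of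
`NSFourierPicard.hasDecay_duhamel_sub` along the two Duhamel formulas from time `0`). -/
theorem hasDecay_sub_half (hV : IsFourierMild c K₀ 0 τ₁ V) (hW : IsFourierMild c K₀ 0 τ₁ W)
    (h0 : V 0 = W 0) (hR : 0 ≤ R) (hVR : ∀ r, HasDecay K₀ R (V r))
    (hWR : ∀ r, HasDecay K₀ R (W r)) (hτ : τ₁ ≤ picardTime (Fin 3) c K₀ R)
    (hd : ∀ r ∈ Icc 0 τ₁, HasDecay K₀ D (V r - W r)) {t : ℝ} (ht : t ∈ Icc 0 τ₁) :
    HasDecay K₀ (D / 2) (V t - W t) := by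
  intro ξ
  have hc := hV.hc
  have hK₀ := hV.hK₀
  set T := picardTime (Fin 3) c K₀ R with hT
  have hTpos : 0 < T := picardTime_pos hc K₀ R hR
  have hD : 0 ≤ D := (hd 0 ⟨le_rfl, hV.le⟩).nonneg
  have htT : t ≤ T := ht.2.trans hτ
  have hvs : ∀ s, Continuous (V s) := hV.continuous_slice
  have hws : ∀ s, Continuous (W s) := hW.continuous_slice
  set C₀ := nonlinConst (Fin 3) K₀ K₀ with hC₀
  have hC₀0 : 0 ≤ C₀ := nonlinConst_nonneg K₀ K₀
  set wt := ((1 + ‖ξ‖) ^ K₀)⁻¹ with hwt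
  have hw0 : 0 < wt := by positivity
  -- the difference is the difference of the Duhamel integrals from time `0`
  have hdiff : V t ξ - W t ξ =
      ∫ s in (0 : ℝ)..t, heat c ξ (t - s) • (nonlin (W s) (W s) ξ - nonlin (V s) (V s) ξ) := by
    rw [hV.duhamel le_rfl ht.1 ht.2 ξ, hW.duhamel le_rfl ht.1 ht.2 ξ, h0, sub_sub_sub_cancel_left,
      ← intervalIntegral.integral_sub (hW.intervalIntegrable_integrand t ξ 0 t)
        (hV.intervalIntegrable_integrand t ξ 0 t)]
    congr 1 with s
    rw [smul_sub]
  -- the bilinear estimate of the difference of the nonlinearities on the window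
  have hNdiff : ∀ s ∈ Icc 0 τ₁, ‖nonlin (V s) (V s) ξ - nonlin (W s) (W s) ξ‖ ≤
      C₀ * (4 * (R * D)) * ‖ξ‖ * wt := by
    intro s hs
    rw [nonlin_self_sub_self hK₀ (hVR s) (hWR s) (hvs s).aestronglyMeasurable
      (hws s).aestronglyMeasurable]
    have hdm : AEStronglyMeasurable (V s - W s) volume :=
      ((hvs s).sub (hws s)).aestronglyMeasurable
    have h1 := norm_nonlin_le hK₀ (hd s hs) (hVR s) hdm (hvs s).aestronglyMeasurable ξ
    have h2 := norm_nonlin_le hK₀ (hWR s) (hd s hs) (hws s).aestronglyMeasurable hdm ξ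
    calc ‖nonlin (V s - W s) (V s) ξ + nonlin (W s) (V s - W s) ξ‖
        ≤ ‖nonlin (V s - W s) (V s) ξ‖ + ‖nonlin (W s) (V s - W s) ξ‖ := norm_add_le _ _
      _ ≤ C₀ * (2 * (D * R)) * ‖ξ‖ * wt + C₀ * (2 * (R * D)) * ‖ξ‖ * wt := add_le_add h1 h2
      _ = C₀ * (4 * (R * D)) * ‖ξ‖ * wt := by ring
  -- bound the integral with the time weight `e^{s/T}`
  set Mξ := C₀ * (4 * (R * D)) * wt with hMξ
  set φ : ℝ → ℝ := fun s => Real.exp (-(c * ‖ξ‖ ^ 2) * (t - s)) * (Mξ * ‖ξ‖ *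
    Real.exp (1 / T * s)) with hφ
  have hφc : Continuous φ := by
    simp only [hφ]
    exact (continuous_heat_comp c continuous_const (continuous_const.sub continuous_id)).mul
      (continuous_const.mul (Real.continuous_exp.comp (continuous_const.mul continuous_id)))
  have h1 : ‖V t ξ - W t ξ‖ ≤ ∫ s in (0 : ℝ)..t, φ s := by
    rw [hdiff]
    refine intervalIntegral.norm_integral_le_of_norm_le ht.1 (Eventually.of_forall fun s hs => ?_)
      (hφc.intervalIntegrable _ _)
    rw [norm_heat_smul, norm_sub_rev]
    refine mul_le_mul_of_nonneg_left ?_ (heat_nonneg _ _ _)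
    have he : 1 ≤ Real.exp (1 / T * s) := Real.one_le_exp (by have := hs.1; positivity)
    calc ‖nonlin (V s) (V s) ξ - nonlin (W s) (W s) ξ‖ ≤ C₀ * (4 * (R * D)) * ‖ξ‖ * wt :=
          hNdiff s ⟨hs.1.le, hs.2.trans ht.2⟩
      _ = Mξ * ‖ξ‖ * 1 := by simp only [hMξ]; ring
      _ ≤ Mξ * ‖ξ‖ * Real.exp (1 / T * s) := by gcongr
  have h2 : ∫ s in (0 : ℝ)..t, φ s ≤ Mξ * (Real.exp (1 / T * t) / (2 * Real.sqrt (c * (1 / T)))) :=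
    integral_heat_mul_le (t := t) hc (by positivity) ht.1 (norm_nonneg ξ) (by positivity)
      (fun s _ => le_rfl) (hφc.intervalIntegrable _ _)
  -- evaluate the gain at `lam = 1/T`, `t ≤ T`
  have hexp : Real.exp (1 / T * t) ≤ Real.exp 1 := by
    apply Real.exp_le_exp.2
    rw [div_mul_eq_mul_div, one_mul, div_le_one hTpos]
    exact htT
  have hsqrt : 2 * Real.sqrt (c * (1 / T)) = 2 * Real.sqrt c / Real.sqrt T := by
    rw [mul_one_div, Real.sqrt_div' c hTpos.le, mul_div_assoc]
  have hθ := picard_theta_le (ι := Fin 3) (K₀ := K₀) hc hR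
  rw [← hT] at hθ
  have hsc : 0 < Real.sqrt c := Real.sqrt_pos.2 hc
  have hsT : 0 < Real.sqrt T := Real.sqrt_pos.2 hTpos
  have hgain : Real.exp (1 / T * t) / (2 * Real.sqrt (c * (1 / T))) ≤
      Real.exp 1 * Real.sqrt T / (2 * Real.sqrt c) := by
    rw [hsqrt, div_div_eq_mul_div]
    rw [div_le_div_iff₀ (by positivity) (by positivity)]
    have := mul_le_mul_of_nonneg_right hexp (by positivity : 0 ≤ Real.sqrt T * (2 * Real.sqrt c))
    linarith [this]
  calc ‖(V t - W t) ξ‖ = ‖V t ξ - W t ξ‖ := rfl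
    _ ≤ Mξ * (Real.exp (1 / T * t) / (2 * Real.sqrt (c * (1 / T)))) := h1.trans h2
    _ ≤ Mξ * (Real.exp 1 * Real.sqrt T / (2 * Real.sqrt c)) := by gcongr
    _ = D * wt * (2 * (Real.exp 1 * C₀ * R * Real.sqrt T / Real.sqrt c)) := by
        simp only [hMξ]; ring
    _ ≤ D * wt * (2 * (1 / 4)) := by gcongr
    _ = D / 2 * wt := by ring

/-- **Geometric decay of the weighted distance on a short window.** Under the hypotheses of
`hasDecay_sub_half`, `‖V(t) − W(t)‖ ≤ (2R/2ⁿ) (1+‖·‖)^{-K₀}` on `[0, τ₁]` for every `n`: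
the trivial bound `2R` halved `n` times. -/
theorem hasDecay_sub_pow (hV : IsFourierMild c K₀ 0 τ₁ V) (hW : IsFourierMild c K₀ 0 τ₁ W)
    (h0 : V 0 = W 0) (hR : 0 ≤ R) (hVR : ∀ r, HasDecay K₀ R (V r))
    (hWR : ∀ r, HasDecay K₀ R (W r)) (hτ : τ₁ ≤ picardTime (Fin 3) c K₀ R) (n : ℕ) :
    ∀ t ∈ Icc 0 τ₁, HasDecay K₀ ((R + R) / 2 ^ n) (V t - W t) := by
  induction n with
  | zero =>
    intro t _
    rw [pow_zero, div_one]
    exact (hVR t).sub (hWR t)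
  | succ n ih =>
    intro t ht
    rw [pow_succ, ← div_div]
    exact hasDecay_sub_half hV hW h0 hR hVR hWR hτ ih ht

/-- **Uniqueness on a short window.** Two mild solutions on `[0, τ₁]`, `τ₁ ≤ picardTime c K₀ R`,
in the order-`K₀` ball of radius `R` at all times, which agree at time `0`, agree on `[0, τ₁]`:
the weighted distance is at most `2R/2ⁿ` for every `n`. -/
theorem eq_on_window (hV : IsFourierMild c K₀ 0 τ₁ V) (hW : IsFourierMild c K₀ 0 τ₁ W)
    (h0 : V 0 = W 0) (hR : 0 ≤ R) (hVR : ∀ r, HasDecay K₀ R (V r))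
    (hWR : ∀ r, HasDecay K₀ R (W r)) (hτ : τ₁ ≤ picardTime (Fin 3) c K₀ R) :
    ∀ t ∈ Icc 0 τ₁, V t = W t := by
  intro t ht
  have hlim : Tendsto (fun n : ℕ => (R + R) / 2 ^ n) atTop (𝓝 0) :=
    tendsto_const_nhds.div_atTop (tendsto_pow_atTop_atTop_of_one_lt one_lt_two)
  funext ξ
  have hle : ‖(V t - W t) ξ‖ ≤ 0 :=
    ge_of_tendsto' hlim fun n => (hasDecay_sub_pow hV hW h0 hR hVR hWR hτ n t ht).norm_le ξ
  have h0' : (V t - W t) ξ = 0 := norm_le_zero_iff.1 hle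
  exact sub_eq_zero.1 h0'

/-- **Re-basing a mild solution at the left end point.** If `V` is mild on `[s, s₁]` then
`τ ↦ V(τ + s)` is mild on `[0, s₁ - s]` (`IsFourierMild.translate` by `-s`). -/
theorem rebase {s s₁ : ℝ} (h : IsFourierMild c K₀ s s₁ V) :
    IsFourierMild c K₀ 0 (s₁ - s) (fun τ => V (τ + s)) := by
  have h' := h.translate (-s)
  simp only [add_neg_cancel, sub_neg_eq_add, ← sub_eq_add_neg] at h'
  exact h'

/-- **Uniqueness of Fourier-side mild solutions** (the registered stub `stub_mildUnique` of the
crux `EnvelopeBound`). Two mild solutions of the transformed Navier–Stokes system on `ℝ³` with the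
same heat rate `c` and weight order `K₀`, on `[t₀, T]` and `[t₀, T']`, which agree at time `t₀`,
agree at every `t` with `t₀ ≤ t ≤ min T T'`: induction over windows of the fixed length
`picardTime c K₀ R`, `R` the common uniform order-`K₀` weight of the two solutions, each window
being handled by `eq_on_window` after re-basing (Leray 1934, §21; Lemarié-Rieusset 2016,
Thm. 7.2). -/
theorem stub_mildUnique :
    ∀ (c : ℝ) (K₀ : ℕ) (t₀ T T' : ℝ)
      (V W : ℝ → EuclideanSpace ℝ (Fin 3) → Fin 3 → ℂ),
      Literature.Analysis.FluidPDE.FourierNS.IsFourierMild c K₀ t₀ T V →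
      Literature.Analysis.FluidPDE.FourierNS.IsFourierMild c K₀ t₀ T' W →
      V t₀ = W t₀ →
      ∀ t : ℝ, t₀ ≤ t → t ≤ T → t ≤ T' → V t = W t := by
  intro c K₀ t₀ T T' V W hV hW h0
  obtain ⟨A, hA0, hA⟩ := hV.decay₀
  obtain ⟨B, _, hB⟩ := hW.decay₀
  set R := max A B with hR
  have hR0 : 0 ≤ R := hA0.trans (le_max_left _ _)
  have hVR : ∀ r, HasDecay K₀ R (V r) := fun r => (hA r).mono (le_max_left _ _)
  have hWR : ∀ r, HasDecay K₀ R (W r) := fun r => (hB r).mono (le_max_right _ _)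
  have hc := hV.hc
  set h := picardTime (Fin 3) c K₀ R with hh
  have hpos : 0 < h := picardTime_pos hc K₀ R hR0
  -- induction over windows of length `h`
  have key : ∀ n : ℕ, ∀ t, t₀ ≤ t → t ≤ T → t ≤ T' → t ≤ t₀ + n * h → V t = W t := by
    intro n
    induction n with
    | zero =>
      intro t h₁ _ _ h₄
      simp only [Nat.cast_zero, zero_mul, add_zero] at h₄
      rw [le_antisymm h₄ h₁]
      exact h0
    | succ n ih =>
      intro t h₁ h₂ h₃ h₄
      by_cases hle : t ≤ t₀ + n * h
      · exact ih t h₁ h₂ h₃ hle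
      push_cast at h₄
      set s := t₀ + n * h with hs
      have hs₀ : t₀ ≤ s := le_add_of_nonneg_right (by positivity)
      have hst : s ≤ t := (not_le.1 hle).le
      have hVs : V s = W s := ih s hs₀ (hst.trans h₂) (hst.trans h₃) le_rfl
      have hV' := rebase (hV.mono hs₀ hst h₂)
      have hW' := rebase (hW.mono hs₀ hst h₃)
      have hts : t - s ≤ h := by linarith
      have heq := eq_on_window hV' hW' (by simpa using hVs) hR0 (fun r => hVR (r + s))
        (fun r => hWR (r + s)) hts (t - s) ⟨sub_nonneg.2 hst, le_rfl⟩
      simpa using heq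
  intro t h₁ h₂ h₃
  obtain ⟨n, hn⟩ := exists_nat_gt ((t - t₀) / h)
  refine key n t h₁ h₂ h₃ ?_
  have := (div_lt_iff₀ hpos).1 hn
  linarith

end Summit.NavierStokesRegularity.NavierStokesRegularity.Theorems.EnvelopeBound.Registered

end
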